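import Summits.HodgeConjecture.HodgeConjecture.Theorems.Ring2AbelianAllAndreCorrespondenceCategory
import HarnessLib

/-!
# Ring 2 · sub-cell AbelianAll (ALL ABELIAN VARIETIES), André axis — ab-andre-1 part XV-a:
# DEGREE-UNIFORM correspondence calculus on the real carriers — one algebraic class realising a
# composite / a Lefschetz twist in EVERY degree at once

HONEST FRAMING (page 1, verbatim): **research route, not a corollary; conditional on HC_CM plus one named
minimal statement.** Cell line: research route conditional on HC_CM; not a corollary; Q11.4-sentence-2
already refuted in dim ≥ 3. Nothing in this file proves an open case of the Hodge conjecture; no conjecture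
occurs in it at all. Seat `pub-hodge-ring2-ab-andre-1`, gen 53; groundwork for part XV-b
(`Ring2AbelianAllStandardBKunnethProjectors`: André's degree-wise `B⋆(X, η)` ⟹ Kleiman's Künneth form `C(X)`,
ONE algebraic class per Künneth projector), itself the input of the converse edges `(5∀) ⟹ Sq∀`,
`(5) ⟹ Sq^CM` of part XIV-g left open there ("stability of `B` under products, NOT typed").

## Why a uniform calculus

The tree's `IsAlgebraicCorrespondence m n W X T` (André 1996 §2.1, `MotivatedClasses`) is a statement about ONE
degree: some algebraic class acts as `T` on `Hᵃ(X(ℂ))`; the same class acts uncontrolled on the other degrees.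
ab-andre-2's correspondence algebra (part XXII-b, `corrAction_comp`, `corrAction_comp_lefschetzPow`) is
accordingly degree-wise: the composite class it produces may depend on the degree (through the scalar of the
Gysin base change `gysin_baseChange`, chosen per degree). Kleiman's `B ⟹ C` (1968 Prop. 1.4.4 / 1994 Thm. 4-1)
and `B(X) ∧ B(Y) ⟹ B(X × Y)` (1968 Cor. 2.5) need ONE class acting as prescribed in ALL degrees. This file
supplies the three uniform tools, all fact-free ports of the Literature proofs with the degree binders moved
inside the existential:

* §1 `gysin_baseChange_uniform` — the base-change scalar `c` of `snd^* ∘ fst_* = c • (X ◁ fst)_* ∘ snd^*`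
  (Fulton Prop. 1.7) can be taken THE SAME in every degree (it is the ratio of two fibre integrals of
  top-degree classes, `Literature.…gysin_baseChange_of_kunneth`, whose proof is repeated verbatim with the
  degree universally quantified after `c`);
* §2 `exists_corrComp` — for algebraic `γ` on `X ⊗ Y`, `γ'` on `Y ⊗ Z` ONE algebraic `γ''` on `X ⊗ Z` with
  `[γ'']_* = [γ]_* ∘ [γ']_*` in every (typed) degree (Fulton §16.1 Prop. 16.1.1);
* §3 `exists_rightTwist` — ONE algebraic `γ'` with `[γ']_* = [γ]_* ∘ Lʳ_η` in every degree (`γ' = pr_X^* ηʳ ∪ γ`);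
* §4 `exists_leftTwist` — ONE algebraic `γ₂` with `[γ₂]_* = Lʳ_ω ∘ [γ]_*` in every degree where `[γ]_*` is
  typed, and `[γ₂]_* = 0` in the degrees below (`γ₂ = pr_W^* ωʳ ∪ γ`; projection formula, and
  `f_*(f^* u ∪ v) = 0` for `deg v < 2(dim E − dim B)`, `complexGysin_cup_map_eq_zero_of_lt`);
* §5 `exists_diagonalClass` — the diagonal `[Δ]` acts as the identity in every degree.

0 `def`, 0 named fact, 0 `sorry`; every statement is about the real carriers `H•(X(ℂ); ℂ)`.
EDGE LABELS: all K (kernel). References: Fulton1998 (Prop. 1.7, §16.1 Def. 16.1.1–2, Prop. 16.1.1);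
FultonYoungTableaux1997 (App. B §B.1 (3), (5), (6)); HatcherAT2002 (§3.2 Prop. 3.10, Thm. 3.11, Thm. 3.15);
VoisinHodgeII2003 (§9.2.4 Prop. 9.20, proof of Thm. 10.17 (10.7)); Buskin2019 (Lemma 6.3);
Kleiman1968AlgebraicCycles (§1.3–1.4, §2 Cor. 2.5, App. 2A11); Andre1996Motifs (§2.1).
-/

noncomputable section

set_option linter.dupNamespace false

namespace Summit.HodgeConjecture.HodgeConjecture.Ring2.AbelianAll

open CategoryTheory AlgebraicGeometry MonoidalCategory CartesianMonoidalCategory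
open Literature.AlgebraicGeometry Literature.AlgebraicGeometry.Motives
open Literature.AlgebraicGeometry.HodgeTheory
open Literature.AlgebraicTopology.SingularHomology (singularCohomology cupProduct cupProduct_assoc
  cupProduct_gradedComm_holds cupProduct_map)
open Literature.Geometry.Kaehler (lefschetzOperator lefschetzPow lefschetzOperator_apply lefschetzPow_zero
  lefschetzPow_succ)

variable (μ : OrientationFamily) {l m n : ℕ} {W X Y Z : SchemeOver ℂ}

/-! ## §1 The Gysin base-change scalar is uniform in the degree -/

/-- **Gysin base change for the product square, with ONE scalar for all degrees** (Fulton Prop. 1.7 / *Young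
Tableaux* App. B): for smooth projective complex `X, Y, Z` (dimensions `l, m, n`) and an orientation family `μ`
there is `c ∈ ℂ` with `snd_{X,Y}^* ((fst_{Y,Z})_* z) = c • (X ◁ fst_{Y,Z})_* (snd_{X, Y ⊗ Z}^* z)` for ALL degrees
`k + 2m = k₁ + 2(m + n)` and all `z ∈ Hᵏ((Y ⊗ Z)(ℂ))`. The proof of the tree's
`Literature.AlgebraicGeometry.HodgeTheory.gysin_baseChange_of_kunneth` chooses `c` as the ratio of the two
degree-`0` fibre integrals of a top-degree class of `Z(ℂ)` — independent of `k` — and then checks the identity on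
Künneth cross products (`kunnethSpan_complexBetti`); it is repeated here with the degree quantified after `c`.
[cite: Fulton1998, Prop. 1.7 and §16.1] [cite: FultonYoungTableaux1997, Appendix B §B.1 (5)–(6)]
[cite: HatcherAT2002, §3.2 Thm. 3.15] -/
theorem gysin_baseChange_uniform (hX : IsSmoothProjective l X) (hY : IsSmoothProjective m Y)
    (hZ : IsSmoothProjective n Z) :
    ∃ c : ℂ, ∀ {k k₁ : ℕ} (hk : k + 2 * m = k₁ + 2 * (m + n)) (z : complexBetti (Y ⊗ Z) k),
      complexBetti.map (snd X Y) k₁ (complexGysin μ (hY.tensor_holds hZ) hY (fst Y Z) hk z) =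
      c • complexGysin μ (hX.tensor_holds (hY.tensor_holds hZ)) (hX.tensor_holds hY) (X ◁ fst Y Z)
          (show k + 2 * (l + m) = k₁ + 2 * (l + (m + n)) by omega)
          (complexBetti.map (snd X (Y ⊗ Z)) k z) := by
  have hμ : μ.HasPoincareDuality := OrientationFamily.hasPoincareDuality μ
  have hYZ := hY.tensor_holds hZ
  have hXY := hX.tensor_holds hY
  have hT := hX.tensor_holds hYZ
  have hK : ∀ ⦃m' n' : ℕ⦄ ⦃Y' Z' : SchemeOver ℂ⦄, IsSmoothProjective m' Y' → IsSmoothProjective n' Z' →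
      ∀ (k : ℕ) (z : complexBetti (Y' ⊗ Z') k), z ∈ Submodule.span ℂ
        {v | ∃ (i j : ℕ) (h : i + j = k) (b : complexBetti Y' i) (w : complexBetti Z' j),
          v = cupProduct h (complexBetti.map (fst Y' Z') i b) (complexBetti.map (snd Y' Z') j w)} :=
    fun _ _ _ _ hY' hZ' ↦ kunnethSpan_complexBetti hY' hZ'
  -- the two degree-`0` fibre integrals `A w = snd^*(fst_* snd^* w)`, `B w = (X ◁ fst)_*(snd^* snd^* w)`
  let A : complexBetti Z (2 * n) →ₗ[ℂ] complexBetti (X ⊗ Y) 0 :=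
    (complexBetti.map (snd X Y) 0).hom ∘ₗ
      complexGysin μ hYZ hY (fst Y Z) (show 2 * n + 2 * m = 0 + 2 * (m + n) by omega) ∘ₗ
      (complexBetti.map (snd Y Z) (2 * n)).hom
  let B : complexBetti Z (2 * n) →ₗ[ℂ] complexBetti (X ⊗ Y) 0 :=
    complexGysin μ hT hXY (X ◁ fst Y Z) (show 2 * n + 2 * (l + m) = 0 + 2 * (l + (m + n)) by omega) ∘ₗ
      (complexBetti.map (snd X (Y ⊗ Z)) (2 * n)).hom ∘ₗ (complexBetti.map (snd Y Z) (2 * n)).hom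
  obtain ⟨w₁, hw₁⟩ := exists_complexGysin_map_ne_zero μ hX hY hZ (hK hX hYZ _) (hK hY hZ _)
  have hBw₁ : B w₁ ≠ 0 := hw₁
  have hw₁0 : w₁ ≠ 0 := by
    rintro rfl
    exact hBw₁ (map_zero B)
  obtain ⟨α, hα⟩ := exists_eq_smul_one μ hXY (A w₁)
  obtain ⟨β, hβ⟩ := exists_eq_smul_one μ hXY (B w₁)
  have hβ0 : β ≠ 0 := by
    rintro rfl
    exact hBw₁ (by rw [hβ, zero_smul])
  -- `A = (α β⁻¹) • B` on the line `H²ⁿ(Z(ℂ)) = ℂ · w₁`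
  have hAB : ∀ w, A w = (α * β⁻¹) • B w := by
    intro w
    obtain ⟨t, rfl⟩ := exists_eq_smul_of_top μ hZ hw₁0 w
    simp only [map_smul, hα, hβ, smul_smul]
    congr 1
    field_simp
  refine ⟨α * β⁻¹, fun {k k₁} hk z ↦ ?_⟩
  -- both sides are linear in `z`: check on cross products
  let F : complexBetti (Y ⊗ Z) k →ₗ[ℂ] complexBetti (X ⊗ Y) k₁ :=
    (complexBetti.map (snd X Y) k₁).hom ∘ₗ complexGysin μ hYZ hY (fst Y Z) hk
  let G : complexBetti (Y ⊗ Z) k →ₗ[ℂ] complexBetti (X ⊗ Y) k₁ :=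
    (α * β⁻¹) • (complexGysin μ hT hXY (X ◁ fst Y Z)
      (show k + 2 * (l + m) = k₁ + 2 * (l + (m + n)) by omega) ∘ₗ
      (complexBetti.map (snd X (Y ⊗ Z)) k).hom)
  change F z = G z
  refine LinearMap.eqOn_span (f := F) (g := G) ?_ (hK hY hZ k z)
  rintro _ ⟨i, j, hij, b, w, rfl⟩
  change complexBetti.map (snd X Y) k₁ (complexGysin μ hYZ hY (fst Y Z) hk
      (cupProduct hij (complexBetti.map (fst Y Z) i b) (complexBetti.map (snd Y Z) j w))) =
    (α * β⁻¹) • complexGysin μ hT hXY (X ◁ fst Y Z) _ (complexBetti.map (snd X (Y ⊗ Z)) k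
      (cupProduct hij (complexBetti.map (fst Y Z) i b) (complexBetti.map (snd Y Z) j w)))
  -- `snd^*(fst^* b ∪ snd^* w) = (X ◁ fst)^* snd^* b ∪ snd^* snd^* w` on `X ⊗ (Y ⊗ Z)`
  have epull : complexBetti.map (snd X (Y ⊗ Z)) k
      (cupProduct hij (complexBetti.map (fst Y Z) i b) (complexBetti.map (snd Y Z) j w)) =
      cupProduct hij (complexBetti.map (X ◁ fst Y Z) i (complexBetti.map (snd X Y) i b))
        (complexBetti.map (snd X (Y ⊗ Z)) j (complexBetti.map (snd Y Z) j w)) := by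
    rw [cupProduct_map, ← CategoryTheory.comp_apply (f := complexBetti.map (fst Y Z) i),
      ← complexBetti.map_comp, ← whiskerLeft_snd, complexBetti.map_comp, CategoryTheory.comp_apply]
  rw [epull]
  rcases lt_trichotomy j (2 * n) with hj | hj | hj
  · -- below the fibre dimension both sides vanish
    rw [complexGysin_cup_map_eq_zero_of_lt hYZ hY (fst Y Z) hij hk (by omega) b,
      complexGysin_cup_map_eq_zero_of_lt hT hXY (X ◁ fst Y Z) hij _ (by omega), map_zero, smul_zero]
  swap
  · haveI := subsingleton_complexBetti hZ hj
    rw [Subsingleton.elim w 0, map_zero, map_zero, map_zero, map_zero, map_zero, map_zero, map_zero,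
      smul_zero]
  subst hj
  obtain rfl : i = k₁ := by omega
  -- projection formula on both sides
  rw [complexGysin_cup hμ hYZ hY (fst Y Z) hij hk (show 2 * n + 2 * m = 0 + 2 * (m + n) by omega)
      (Nat.add_zero _) b, cupProduct_map,
    complexGysin_cup hμ hT hXY (X ◁ fst Y Z) hij _
      (show 2 * n + 2 * (l + m) = 0 + 2 * (l + (m + n)) by omega) (Nat.add_zero _)]
  change cupProduct _ (complexBetti.map (snd X Y) i b) (A w) =
    (α * β⁻¹) • cupProduct _ (complexBetti.map (snd X Y) i b) (B w)
  rw [hAB w, map_smul]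

/-! ## §2 Composition, uniformly in the degree -/

/-- **ONE composite class for all degrees** (Fulton §16.1 Prop. 16.1.1 on the real carriers): for smooth projective
`X, Y, Z` (dimensions `l, m, n`) and ALGEBRAIC `γ ∈ Nᵉ H^{2e}((X ⊗ Y)(ℂ))`, `γ' ∈ Nᵉ' H^{2e'}((Y ⊗ Z)(ℂ))`,
`e + e' = e'' + m`, there is ONE algebraic `γ'' ∈ Nᵉ'' H^{2e''}((X ⊗ Z)(ℂ))` — `γ'' = c • p₁₃_*(p₁₂^* γ ∪ p₂₃^* γ')`
with the uniform scalar of §1 — such that `[γ'']_* = [γ]_* ∘ [γ']_*` on `Hᵃ(Z(ℂ))` for EVERY degree `a` in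
which the composite is typed (ab-andre-2's `corrAction_comp`, part XXII-b, is the degree-wise statement; the
proof is the same, through `Literature.…corr_comp_of_baseChange` and `corrCompClass_mem_algebraicClasses`).
[cite: Fulton1998, §16.1 Def. 16.1.1 and Prop. 16.1.1] [cite: Buskin2019, Lemma 6.3]
[cite: VoisinHodgeII2003, §9.2.4 Prop. 9.20] -/
theorem exists_corrComp (hX : IsSmoothProjective l X) (hY : IsSmoothProjective m Y) (hZ : IsSmoothProjective n Z)
    {e e' e'' : ℕ} (he : e + e' = e'' + m)
    {γ : complexBetti (X ⊗ Y) (2 * e)} (hγ : γ ∈ algebraicClasses (X ⊗ Y) e)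
    {γ' : complexBetti (Y ⊗ Z) (2 * e')} (hγ' : γ' ∈ algebraicClasses (Y ⊗ Z) e') :
    ∃ γ'' ∈ algebraicClasses (X ⊗ Z) e'', ∀ {a a₁ a₂ : ℕ} (h₁ : a + 2 * e' = a₁ + 2 * n)
      (h₂ : a₁ + 2 * e = a₂ + 2 * m) (h₃ : a + 2 * e'' = a₂ + 2 * n),
      corrAction μ hX hZ h₃ γ'' = corrAction μ hX hY h₂ γ ∘ₗ corrAction μ hY hZ h₁ γ' := by
  have hμ : μ.HasPoincareDuality := OrientationFamily.hasPoincareDuality μ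
  obtain ⟨c, hc⟩ := gysin_baseChange_uniform μ hX hY hZ
  have hT := hX.tensor_holds (hY.tensor_holds hZ)
  refine ⟨c • complexGysin μ hT (hX.tensor_holds hZ) (X ◁ snd Y Z)
      (show 2 * (e + e') + 2 * (l + n) = 2 * e'' + 2 * (l + (m + n)) by omega)
      (cupProduct ((Nat.mul_add 2 e e').symm : 2 * e + 2 * e' = 2 * (e + e'))
        (complexBetti.map (X ◁ fst Y Z) (2 * e) γ) (complexBetti.map (snd X (Y ⊗ Z)) (2 * e') γ')),
    Submodule.smul_mem _ _ (corrCompClass_mem_algebraicClasses hμ hX hY hZ he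
      (fun a ha b hb ↦ Summit.HodgeConjecture.HodgeConjecture.Theorems.Voisin2003_cupProduct_algebraicClasses_holds hT
        ha hb) hγ hγ'), fun {a a₁ a₂} h₁ h₂ h₃ ↦ ?_⟩
  refine LinearMap.ext fun y ↦ ?_
  rw [LinearMap.comp_apply, corrAction_apply, corrAction_apply, corrAction_apply]
  exact corr_comp_of_baseChange hμ hX hY hZ h₁ h₂ (show 2 * e + 2 * e' = 2 * e'' + 2 * m by omega)
    ((Nat.mul_add 2 e e').symm) γ γ' c
    (fun z ↦ hc (show a + 2 * e' + 2 * m = a₁ + 2 * (m + n) by omega) z) y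

/-! ## §3 Right Lefschetz twists, uniformly in the degree: `[pr_X^* ηʳ ∪ γ]_* = [γ]_* ∘ Lʳ_η` -/

/-- **One right twist, all degrees.** For `η ∈ N¹ H²(X(ℂ))` and `γ ∈ Nᵉ H^{2e}((W ⊗ X)(ℂ))` algebraic, the ONE class
`γ₁ = pr_X^* η ∪ γ ∈ Nᵉ⁺¹` satisfies `[γ₁]_* x = [γ]_*(η ∪ x)` for `x` of EVERY degree (ab-andre-2's
`corrAction_comp_lefschetzOperator` with the degree binders moved inside; Hatcher 3.10–3.11, Voisin II Prop. 9.20).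
[cite: VoisinHodgeII2003, §9.2.4 Prop. 9.20 and proof of Thm. 10.17 (10.7)] [cite: HatcherAT2002, §3.2 Prop. 3.10 and Thm. 3.11] -/
theorem exists_rightTwist_one (hW : IsSmoothProjective m W) (hX : IsSmoothProjective n X)
    {η : complexBetti X 2} (hη : η ∈ algebraicClasses X 1) {e : ℕ}
    {γ : complexBetti (W ⊗ X) (2 * e)} (hγ : γ ∈ algebraicClasses (W ⊗ X) e) :
    ∃ γ₁ ∈ algebraicClasses (W ⊗ X) (e + 1), ∀ {a₁ a₂ b : ℕ} (h12 : 2 + a₁ = a₂)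
      (hab : a₂ + 2 * e = b + 2 * n) (hab₁ : a₁ + 2 * (e + 1) = b + 2 * n) (x : complexBetti X a₁),
      corrAction μ hW hX hab₁ γ₁ x = corrAction μ hW hX hab γ (lefschetzOperator η h12 x) := by
  have hWX := hW.tensor_holds hX
  have hηWX : complexBetti.map (snd W X) 2 η ∈ algebraicClasses (W ⊗ X) 1 :=
    map_snd_mem_supportedClasses hW hX (a := 2 * 1) hη
  have hγ₁ : cupProduct (show 2 * 1 + 2 * e = 2 * (e + 1) by omega) (complexBetti.map (snd W X) 2 η) γ ∈
      algebraicClasses (W ⊗ X) (e + 1) := by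
    have h := Summit.HodgeConjecture.HodgeConjecture.Theorems.Voisin2003_cupProduct_algebraicClasses_holds hWX hηWX hγ
    exact (cupProduct_mem_supportedClasses_congr (two_mul_add_two_mul 1 e) (show 2 * 1 + 2 * e = 2 * (e + 1) by omega)
      (Nat.add_comm 1 e) _ _).1 h
  refine ⟨_, hγ₁, fun {a₁ a₂ b} h12 hab hab₁ x ↦ ?_⟩
  rw [corrAction_apply, corrAction_apply, lefschetzOperator_apply, complexBetti.map_cupProduct]
  rw [cupProduct_gradedComm_holds ℂ _ h12 (show a₁ + 2 = a₂ by omega) (complexBetti.map (snd W X) 2 η)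
    (complexBetti.map (snd W X) a₁ x)]
  have heven : ((-1 : ℂ) ^ (2 * a₁)) = 1 := by rw [pow_mul, neg_one_sq, one_pow]
  rw [heven, one_smul]
  rw [cupProduct_assoc (show a₁ + 2 = a₂ by omega) (show 2 * 1 + 2 * e = 2 * (e + 1) by omega) rfl
    (show a₁ + 2 * (e + 1) = a₂ + 2 * e by omega)]
  exact complexGysin_cupProduct_congr μ hWX hW (fst W X) rfl _ _ _ _ _

/-- **Iterated right twist, all degrees**: ONE algebraic `γ'` of codimension `e' = e + r` (namely `pr_X^* ηʳ ∪ γ`) with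
`[γ']_* x = [γ]_*(Lʳ_η x)` for `x` of every degree. [cite: VoisinHodgeII2003, §9.2.4 Prop. 9.20 and proof of Thm. 10.17 (10.7)] -/
theorem exists_rightTwist (hW : IsSmoothProjective m W) (hX : IsSmoothProjective n X)
    {η : complexBetti X 2} (hη : η ∈ algebraicClasses X 1) :
    ∀ (r : ℕ) {e e' : ℕ} (_he : e + r = e') {γ : complexBetti (W ⊗ X) (2 * e)}
      (_hγ : γ ∈ algebraicClasses (W ⊗ X) e),
      ∃ γ' ∈ algebraicClasses (W ⊗ X) e', ∀ {a b : ℕ} (hab : a + 2 * r + 2 * e = b + 2 * n)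
        (hab' : a + 2 * e' = b + 2 * n) (x : complexBetti X a),
        corrAction μ hW hX hab' γ' x = corrAction μ hW hX hab γ (lefschetzPow η r a x)
  | 0, e, e', he, γ, hγ => by
    obtain rfl : e = e' := by omega
    exact ⟨γ, hγ, fun hab hab' x ↦ by rw [lefschetzPow_zero, LinearMap.id_apply]⟩
  | r + 1, e, e', he, γ, hγ => by
    obtain ⟨γ₁, hγ₁, h₁⟩ := exists_rightTwist_one μ hW hX hη hγ
    obtain ⟨γ', hγ', h'⟩ := exists_rightTwist hW hX hη r (show e + 1 + r = e' by omega) hγ₁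
    refine ⟨γ', hγ', fun {a b} hab hab' x ↦ ?_⟩
    rw [h' (show a + 2 * r + 2 * (e + 1) = b + 2 * n by omega) hab' x, lefschetzPow_succ, LinearMap.comp_apply,
      h₁ (show 2 + (a + 2 * r) = a + 2 * (r + 1) by omega) hab]

/-! ## §4 Left Lefschetz twists, uniformly in the degree: `[pr_W^* ωʳ ∪ γ]_* = Lʳ_ω ∘ [γ]_*`, and `0` below -/

/-- **One left twist, all degrees.** For `ω ∈ N¹ H²(W(ℂ))` and `γ ∈ Nᵉ H^{2e}((W ⊗ X)(ℂ))` algebraic, the ONE class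
`γ₂ = pr_W^* ω ∪ γ ∈ Nᵉ⁺¹` satisfies (i) `[γ₂]_* x = ω ∪ [γ]_* x` for `x` of every degree `a` with `a + 2e ≥ 2 dim X`
(projection formula `pr_{W*}(pr_W^* ω ∪ y) = ω ∪ pr_{W*} y`, Fulton (6)), and (ii) `[γ₂]_* = 0` on `Hᵃ(X(ℂ))` for
`a + 2e < 2 dim X`, where `[γ]_*` has no target degree (`pr_{W*}(pr_W^* ω ∪ v) = 0` for `deg v < 2 dim X`, the tree's
`complexGysin_cup_map_eq_zero_of_lt`). [cite: FultonYoungTableaux1997, Appendix B §B.1 (3) and (6)]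
[cite: VoisinHodgeII2003, §9.2.4 Prop. 9.20 and proof of Thm. 10.17 (10.7)] -/
theorem exists_leftTwist_one (hW : IsSmoothProjective m W) (hX : IsSmoothProjective n X)
    {ω : complexBetti W 2} (hω : ω ∈ algebraicClasses W 1) {e : ℕ}
    {γ : complexBetti (W ⊗ X) (2 * e)} (hγ : γ ∈ algebraicClasses (W ⊗ X) e) :
    ∃ γ₂ ∈ algebraicClasses (W ⊗ X) (e + 1),
      (∀ {a b b₂ : ℕ} (hab : a + 2 * e = b + 2 * n) (h12 : 2 + b = b₂) (hab₂ : a + 2 * (e + 1) = b₂ + 2 * n)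
        (x : complexBetti X a),
        corrAction μ hW hX hab₂ γ₂ x = lefschetzOperator ω h12 (corrAction μ hW hX hab γ x)) ∧
      (∀ {a b₂ : ℕ} (hab₂ : a + 2 * (e + 1) = b₂ + 2 * n), a + 2 * e < 2 * n →
        corrAction μ hW hX hab₂ γ₂ = 0) := by
  have hμ : μ.HasPoincareDuality := OrientationFamily.hasPoincareDuality μ
  have hWX := hW.tensor_holds hX
  have hωWX : complexBetti.map (fst W X) 2 ω ∈ algebraicClasses (W ⊗ X) 1 :=
    map_fst_mem_supportedClasses hW hX (a := 2 * 1) hω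
  have h1e : 2 + 2 * e = 2 * (e + 1) := by omega
  have hγ₂ : cupProduct h1e (complexBetti.map (fst W X) 2 ω) γ ∈ algebraicClasses (W ⊗ X) (e + 1) := by
    have h := Summit.HodgeConjecture.HodgeConjecture.Theorems.Voisin2003_cupProduct_algebraicClasses_holds hWX hωWX hγ
    exact (cupProduct_mem_supportedClasses_congr (two_mul_add_two_mul 1 e) (show 2 * 1 + 2 * e = 2 * (e + 1) by omega)
      (Nat.add_comm 1 e) _ _).1 h
  -- `pr_X^* x ∪ (pr_W^* ω ∪ γ) = pr_W^* ω ∪ (pr_X^* x ∪ γ)` (degree `2` is even), in the degree spelling `2 + (a + 2e)`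
  have key : ∀ {a : ℕ} (x : complexBetti X a),
      cupProduct (rfl : a + 2 * (e + 1) = a + 2 * (e + 1)) (complexBetti.map (snd W X) a x)
        (cupProduct h1e (complexBetti.map (fst W X) 2 ω) γ) =
      cupProduct (show 2 + (a + 2 * e) = a + 2 * (e + 1) by omega) (complexBetti.map (fst W X) 2 ω)
        (cupProduct (rfl : a + 2 * e = a + 2 * e) (complexBetti.map (snd W X) a x) γ) := by
    intro a x
    rw [← cupProduct_assoc (rfl : a + 2 = a + 2) h1e (show a + 2 + 2 * e = a + 2 * (e + 1) by omega) rfl,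
      cupProduct_gradedComm_holds ℂ _ (rfl : a + 2 = a + 2) (Nat.add_comm 2 a) (complexBetti.map (snd W X) a x)
        (complexBetti.map (fst W X) 2 ω), map_smul, LinearMap.smul_apply]
    have heven : ((-1 : ℂ) ^ (a * 2)) = 1 := by rw [pow_mul', neg_one_sq, one_pow]
    rw [heven, one_smul, cupProduct_assoc (Nat.add_comm 2 a) (rfl : a + 2 * e = a + 2 * e)
      (show a + 2 + 2 * e = a + 2 * (e + 1) by omega) (show 2 + (a + 2 * e) = a + 2 * (e + 1) by omega)]
  refine ⟨_, hγ₂, fun {a b b₂} hab h12 hab₂ x ↦ ?_, fun {a b₂} hab₂ hlt ↦ ?_⟩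
  · -- projection formula `pr_{W*}(pr_W^* ω ∪ y) = ω ∪ pr_{W*} y`
    rw [corrAction_apply, corrAction_apply, lefschetzOperator_apply,
      ← complexGysin_cup hμ hWX hW (fst W X) (show 2 + (a + 2 * e) = a + 2 * (e + 1) by omega)
        (show a + 2 * (e + 1) + 2 * m = b₂ + 2 * (m + n) by omega) (corrAction_degree m hab) h12 ω
        (cupProduct (rfl : a + 2 * e = a + 2 * e) (complexBetti.map (snd W X) a x) γ), key x]
  · -- below the fibre dimension: `pr_{W*}(pr_W^* ω ∪ v) = 0` for `deg v = a + 2e < 2 dim X`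
    refine LinearMap.ext fun x ↦ ?_
    rw [corrAction_apply, LinearMap.zero_apply, key x]
    exact complexGysin_cup_map_eq_zero_of_lt hWX hW (fst W X) (show 2 + (a + 2 * e) = a + 2 * (e + 1) by omega) _
      (by omega) ω _

/-- **Iterated left twist, all degrees**: ONE algebraic `γ₂` of codimension `e' = e + r` (namely `pr_W^* ωʳ ∪ γ`) with
(i) `[γ₂]_* x = Lʳ_ω ([γ]_* x)` for `x` of every degree `a` with `a + 2e ≥ 2 dim X` and (ii) `[γ₂]_* = 0` on `Hᵃ(X(ℂ))`
for `a + 2e < 2 dim X`. [cite: FultonYoungTableaux1997, Appendix B §B.1 (3) and (6)]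
[cite: VoisinHodgeII2003, §9.2.4 Prop. 9.20 and proof of Thm. 10.17 (10.7)] -/
theorem exists_leftTwist (hW : IsSmoothProjective m W) (hX : IsSmoothProjective n X)
    {ω : complexBetti W 2} (hω : ω ∈ algebraicClasses W 1) :
    ∀ (r : ℕ) {e e' : ℕ} (_he : e + r = e') {γ : complexBetti (W ⊗ X) (2 * e)}
      (_hγ : γ ∈ algebraicClasses (W ⊗ X) e),
      ∃ γ₂ ∈ algebraicClasses (W ⊗ X) e',
        (∀ {a b : ℕ} (hab : a + 2 * e = b + 2 * n) (hab₂ : a + 2 * e' = b + 2 * r + 2 * n) (x : complexBetti X a),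
          corrAction μ hW hX hab₂ γ₂ x = lefschetzPow ω r b (corrAction μ hW hX hab γ x)) ∧
        (∀ {a b₂ : ℕ} (hab₂ : a + 2 * e' = b₂ + 2 * n), a + 2 * e < 2 * n → corrAction μ hW hX hab₂ γ₂ = 0)
  | 0, e, e', he, γ, hγ => by
    obtain rfl : e = e' := by omega
    exact ⟨γ, hγ, fun hab hab₂ x ↦ by rw [lefschetzPow_zero, LinearMap.id_apply], fun hab₂ hlt ↦ absurd hlt (by omega)⟩
  | r + 1, e, e', he, γ, hγ => by
    obtain ⟨γ₁, hγ₁, h₁, h₁0⟩ := exists_leftTwist hW hX hω r (rfl : e + r = e + r) hγ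
    obtain ⟨γ₂, hγ₂, h₂, h₂0⟩ := exists_leftTwist_one μ hW hX hω hγ₁
    obtain rfl : e' = e + r + 1 := by omega
    refine ⟨γ₂, hγ₂, fun {a b} hab hab₂ x ↦ ?_, fun {a b₂} hab₂ hlt ↦ ?_⟩
    · rw [h₂ (show a + 2 * (e + r) = b + 2 * r + 2 * n by omega) (show 2 + (b + 2 * r) = b + 2 * (r + 1) by omega)
        hab₂ x, h₁ hab _ x, lefschetzPow_succ, LinearMap.comp_apply]
    · by_cases hlt' : a + 2 * (e + r) < 2 * n
      · exact h₂0 hab₂ hlt'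
      · obtain ⟨b, hb⟩ : ∃ b, a + 2 * (e + r) = b + 2 * n := ⟨a + 2 * (e + r) - 2 * n, by omega⟩
        obtain rfl : b₂ = 2 + b := by omega
        refine LinearMap.ext fun x ↦ ?_
        rw [LinearMap.zero_apply, h₂ hb rfl hab₂ x, h₁0 hb hlt, LinearMap.zero_apply, map_zero]

/-! ## §5 The diagonal acts as the identity in every degree -/

/-- **ONE class acting as the identity in every degree**: the diagonal `[Δ] = (𝟙, 𝟙)_* 1 ∈ Nⁿ H²ⁿ((X ⊗ X)(ℂ); ℂ)` is
algebraic (`complexGysin_graph_one_mem_algebraicClasses`) and `[Δ]_* = id` on `Hᵃ(X(ℂ); ℂ)` for every `a`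
(`corrClassAction_graph` for `f = 𝟙` in degrees `a ≤ 2n`; above `2n` the carrier is null). [cite: Andre1996Motifs, §2.1 (p. 15)]
[cite: FultonYoungTableaux1997, Appendix B §B.1 (5)–(6)] -/
theorem exists_diagonalClass (hX : IsSmoothProjective n X) :
    ∃ δ ∈ algebraicClasses (X ⊗ X) n, ∀ a : ℕ,
      corrAction complexOrientationFamily hX hX (rfl : a + 2 * n = a + 2 * n) δ = LinearMap.id := by
  refine ⟨complexGysin complexOrientationFamily hX (hX.tensor_holds hX) (lift (𝟙 X) (𝟙 X))
      (show 0 + 2 * (n + n) = 2 * n + 2 * n by omega) (singularCohomology.one ℂ (ComplexPoints X)),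
    complexGysin_graph_one_mem_algebraicClasses complexOrientationFamily hasPoincareDuality_complexOrientationFamily hX
      (hX.tensor_holds hX) (𝟙 X), fun a ↦ LinearMap.ext fun c ↦ ?_⟩
  by_cases ha : a ≤ 2 * n
  · rw [corrAction_eq_corrClassAction complexOrientationFamily hX hX rfl (show a + (2 * n - a) = 2 * n by omega),
      corrClassAction_graph complexOrientationFamily hasPoincareDuality_complexOrientationFamily hX (hX.tensor_holds hX)
        (𝟙 X) _ c, complexBetti.map_id, LinearMap.id_apply]
    rfl
  · haveI := subsingleton_complexBetti hX (show 2 * n < a by omega)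
    exact Subsingleton.elim _ _

end Summit.HodgeConjecture.HodgeConjecture.Ring2.AbelianAll

end
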